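import Summits.CriticalPhenomena.PercolationContinuityZ3.Theorems.PercNearOneGluingNoHeavyLowerTailHullThreeCertificate
import Summits.CriticalPhenomena.PercolationContinuityZ3.Theorems.PercNearOneGluingNoHeavyLowerTailCILCutObserverTools
import HarnessLib

/-!
# `NoHeavyLowerTail` (stmt-CriticalPhenomena-4575) — hull-port line, THREE PORTS: the join lemma

Hull-port prover #4 (`prim-hp-4`, LP-duality technique), generation 2; `--supports stmt-CriticalPhenomena-4575`.  No sorries, no named
facts.  Companion of `…HullThreeCertificate` (bit records `IB`, `OB`, the computable join `jrel`).

A THREE-PORT HULL (`Hull3`) is: weights `w` on `Fin n`, a region `R` (a finite vertex set containing the observer `o`), three distinct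
PORTS `p 0, p 1, p 2` outside `R`, and the closure property: every positive-weight pair with an endpoint in `R` has both endpoints in
`R ∪ {p 0, p 1, p 2}`.  (In the crux: `R` = the Steiner region of `o` — `o` and the non-relay vertices reachable from `o` avoiding the
relays — and the ports are the relays adjacent to it; but neither connectedness of `R` nor `p i ∈ A` is needed here.)  INNER pairs
`X.F` = pairs meeting `R`; the inner / outer open graphs of a configuration `ω` are `openGraph (ω ∩ F)` / `openGraph (ω ∩ Fᶜ)`; the named
points `none = o`, `some i = p i` carry the inner bits `X.ibits ω : IB` and the outer bits `X.obits ω : OB`.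

* `Hull3.reach_iff_join` (**join lemma**): on the support event (every open pair has positive weight), for a named point `u` and a
  vertex `a ∉ R`:  `u ↔ a` in `ω`  iff  some port `p i` is `jrel`-joined to `u` and outer-joined to `a`.  Proof: an open walk splits at
  its visits to the ports into inner and outer segments (induction on the walk), and on four named points the reflexive–transitive
  closure of "inner- or outer-joined" is `jrel` (a path of length ≤ 3, via `Walk.IsPath.length_lt`).
* `Hull3.reach_port_iff`: `u ↔ p k` in `ω` iff `jrel (ibits ω) (obits ω) u (some k)`.
* `Hull3.closed_ibits`: the inner bits of a configuration form a closed pattern.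
-/

noncomputable section

namespace Summit.CriticalPhenomena.PercolationContinuityZ3.Theorems

open MeasureTheory Set Literature.Probability.LatticeModels Literature.Probability.Percolation
open scoped Classical

variable {n : ℕ}

namespace HullThree

/-- A three-port hull: weights, region `R ∋ o`, three distinct ports outside `R`, and the closure property of `R`. -/
structure Hull3 (n : ℕ) where
  /-- edge weights -/
  w : Sym2 (Fin n) → unitInterval
  /-- the region -/
  R : Finset (Fin n)
  /-- the observer -/
  o : Fin n
  /-- the ports -/
  p : Fin 3 → Fin n
  /-- the observer lies in the region -/
  ho : o ∈ R
  /-- the ports lie outside the region -/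
  hp : ∀ i, p i ∉ R
  /-- the ports are distinct -/
  hpinj : Function.Injective p
  /-- closure: a positive-weight pair at a region vertex ends in the region or at a port -/
  hregion : ∀ u ∈ R, ∀ v, v ∉ R → (∀ i, v ≠ p i) → w s(u, v) = 0

namespace Hull3

variable (X : Hull3 n)

/-- The inner pairs: those meeting the region. -/
def F : Finset (Sym2 (Fin n)) := Finset.univ.filter fun e => ∃ u ∈ X.R, u ∈ e

/-- The named points as vertices: `none ↦ o`, `some i ↦ p i`. -/
def vtx : NP → Fin n
  | none => X.o
  | some i => X.p i

/-- The inner open graph of a configuration. -/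
def Gin (ω : BondConfig (Fin n)) : SimpleGraph (Fin n) := openGraph (ω ∩ ↑X.F)

/-- The outer open graph of a configuration. -/
def Gout (ω : BondConfig (Fin n)) : SimpleGraph (Fin n) := openGraph (ω ∩ (↑X.F)ᶜ)

/-- Inner relation on named points: distinct and inner-joined. -/
def ir (ω : BondConfig (Fin n)) (u v : NP) : Bool := decide (u ≠ v ∧ (X.Gin ω).Reachable (X.vtx u) (X.vtx v))

/-- Outer relation on named points: distinct ports, outer-joined. -/
def orr (ω : BondConfig (Fin n)) : NP → NP → Bool
  | some i, some k => decide (i ≠ k ∧ (X.Gout ω).Reachable (X.p i) (X.p k))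
  | _, _ => false

/-- The inner bits of a configuration. -/
def ibits (ω : BondConfig (Fin n)) : IB :=
  ⟨X.ir ω none (some 0), X.ir ω none (some 1), X.ir ω none (some 2), X.ir ω (some 0) (some 1), X.ir ω (some 0) (some 2),
    X.ir ω (some 1) (some 2)⟩

/-- The outer bits of a configuration. -/
def obits (ω : BondConfig (Fin n)) : OB :=
  ⟨X.orr ω (some 0) (some 1), X.orr ω (some 0) (some 2), X.orr ω (some 1) (some 2)⟩

/-- The support event: every open pair has nonzero weight (full measure, `CutObserver.measureReal_inter_support`). -/
def supp : Set (BondConfig (Fin n)) := {ω | ∀ e ∈ ω, X.w e ≠ 0}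

/-- The same hull with its ports relabelled by a permutation of `Fin 3`. -/
def perm (σ : Equiv.Perm (Fin 3)) : Hull3 n where
  w := X.w
  R := X.R
  o := X.o
  p := X.p ∘ σ
  ho := X.ho
  hp := fun i => X.hp (σ i)
  hpinj := X.hpinj.comp σ.injective
  hregion := fun u hu v hv hne => X.hregion u hu v hv fun i => by
    have := hne (σ.symm i)
    simpa using this

variable {X}

/-- The inner relation is symmetric. -/
theorem ir_symm (ω : BondConfig (Fin n)) (u v : NP) : X.ir ω u v = X.ir ω v u := by
  simp only [ir, ne_comm, SimpleGraph.reachable_comm]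

/-- The outer relation is symmetric. -/
theorem orr_symm (ω : BondConfig (Fin n)) (u v : NP) : X.orr ω u v = X.orr ω v u := by
  rcases u with _ | i <;> rcases v with _ | k <;> simp only [orr, ne_comm, SimpleGraph.reachable_comm]

/-- The inner relation table of `ibits ω` is `ir ω`. -/
theorem rel_ibits (ω : BondConfig (Fin n)) (u v : NP) : (X.ibits ω).rel u v = X.ir ω u v := by
  rcases u with _ | i <;> rcases v with _ | k
  · simp [IB.rel, ir]
  · fin_cases k <;> rfl
  · fin_cases i <;> (rw [ir_symm]; rfl)
  · fin_cases i <;> fin_cases k <;> first | rfl | (rw [ir_symm]; rfl)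

/-- The outer relation table of `obits ω` is `orr ω`. -/
theorem rel_obits (ω : BondConfig (Fin n)) (u v : NP) : (X.obits ω).rel u v = X.orr ω u v := by
  rcases u with _ | i <;> rcases v with _ | k
  · rfl
  · rfl
  · rfl
  · fin_cases i <;> fin_cases k <;> first | rfl | (rw [orr_symm]; rfl)

/-- Semantics of one `base` step. -/
theorem base_iff (ω : BondConfig (Fin n)) (u v : NP) :
    base (X.ibits ω) (X.obits ω) u v = true ↔
      u = v ∨ (X.Gin ω).Reachable (X.vtx u) (X.vtx v) ∨
        ∃ i k : Fin 3, u = some i ∧ v = some k ∧ (X.Gout ω).Reachable (X.p i) (X.p k) := by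
  rw [base, Bool.or_eq_true, Bool.or_eq_true, rel_ibits, rel_obits, decide_eq_true_iff]
  constructor
  · rintro ((h | h) | h)
    · exact Or.inl h
    · simp only [ir, decide_eq_true_iff] at h
      exact Or.inr (Or.inl h.2)
    · rcases u with _ | i <;> rcases v with _ | k <;> simp only [orr, decide_eq_true_iff] at h
      · exact absurd h Bool.false_ne_true
      · exact absurd h Bool.false_ne_true
      · exact absurd h Bool.false_ne_true
      · exact Or.inr (Or.inr ⟨i, k, rfl, rfl, h.2⟩)
  · rintro (h | h | ⟨i, k, rfl, rfl, h⟩)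
    · exact Or.inl (Or.inl h)
    · by_cases huv : u = v
      · exact Or.inl (Or.inl huv)
      · refine Or.inl (Or.inr ?_)
        simp only [ir, decide_eq_true_iff]
        exact ⟨huv, h⟩
    · by_cases hik : i = k
      · exact Or.inl (Or.inl (by rw [hik]))
      · refine Or.inr ?_
        simp only [orr, decide_eq_true_iff]
        exact ⟨hik, h⟩

/-- The join graph on the named points: adjacency = one `base` step between distinct points. -/
def JG (X : Hull3 n) (ω : BondConfig (Fin n)) : SimpleGraph NP :=
  SimpleGraph.fromRel fun u v => base (X.ibits ω) (X.obits ω) u v = true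

/-- `base` is symmetric (kernel decision). -/
theorem base_symm (b : IB) (c : OB) : ∀ u v : NP, base b c u v = base b c v u := by
  revert b c; decide +kernel

/-- `base` is reflexive. -/
theorem base_refl (b : IB) (c : OB) (u : NP) : base b c u u = true := by
  simp [base]

/-- Adjacency in the join graph. -/
theorem JG_adj (ω : BondConfig (Fin n)) (u v : NP) :
    (X.JG ω).Adj u v ↔ u ≠ v ∧ base (X.ibits ω) (X.obits ω) u v = true := by
  rw [JG, SimpleGraph.fromRel_adj, ← base_symm _ _ u v, or_self]

/-- A `base` step is a join-graph step (or trivial). -/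
theorem JG_reach_of_base (ω : BondConfig (Fin n)) {u v : NP} (h : base (X.ibits ω) (X.obits ω) u v = true) :
    (X.JG ω).Reachable u v := by
  by_cases huv : u = v
  · rw [huv]
  · exact SimpleGraph.Adj.reachable ((JG_adj ω u v).2 ⟨huv, h⟩)

/-- `jrel` is reachability in the join graph: on four points every path has length ≤ 3. -/
theorem jrel_iff_JG (ω : BondConfig (Fin n)) (u v : NP) :
    jrel (X.ibits ω) (X.obits ω) u v = true ↔ (X.JG ω).Reachable u v := by
  constructor
  · rw [jrel_eq_true_iff]
    rintro ⟨a, a', h1, h2, h3⟩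
    exact ((JG_reach_of_base ω h1).trans (JG_reach_of_base ω h2)).trans (JG_reach_of_base ω h3)
  · intro h
    refine h.elim_path fun q => ?_
    have hlen : q.1.length < 4 := by
      have := q.2.length_lt
      simpa using this
    rw [jrel_eq_true_iff]
    obtain ⟨q, hq⟩ := q
    have step : ∀ {x y : NP}, (X.JG ω).Adj x y → base (X.ibits ω) (X.obits ω) x y = true :=
      fun hxy => ((JG_adj ω _ _).1 hxy).2
    rcases q with _ | ⟨h1, q1⟩
    · exact ⟨u, u, base_refl _ _ _, base_refl _ _ _, base_refl _ _ _⟩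
    · rcases q1 with _ | ⟨h2, q2⟩
      · exact ⟨v, v, step h1, base_refl _ _ _, base_refl _ _ _⟩
      · rcases q2 with _ | ⟨h3, q3⟩
        · exact ⟨_, v, step h1, step h2, base_refl _ _ _⟩
        · rcases q3 with _ | ⟨h4, q4⟩
          · exact ⟨_, _, step h1, step h2, step h3⟩
          · simp only [SimpleGraph.Walk.length_cons] at hlen
            omega

/-! ### The walk decomposition -/

/-- On the support event an open inner pair has both endpoints in `R ∪ {ports}`. -/
theorem endpoints_of_inner {ω : BondConfig (Fin n)} (hω : ω ∈ X.supp) {x y : Fin n} (hxy : s(x, y) ∈ ω)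
    (hF : s(x, y) ∈ X.F) (z : Fin n) (hz : z ∈ s(x, y)) : z ∈ X.R ∨ ∃ i, z = X.p i := by
  by_contra hcon
  simp only [not_or, not_exists] at hcon
  obtain ⟨u, huR, hu⟩ := (Finset.mem_filter.1 hF).2
  -- the other endpoint
  have hne : X.w s(x, y) ≠ 0 := hω _ hxy
  rcases Sym2.mem_iff.1 hu with rfl | rfl <;> rcases Sym2.mem_iff.1 hz with rfl | rfl
  · exact hcon.1 huR
  · exact hne (X.hregion _ huR _ hcon.1 hcon.2)
  · rw [Sym2.eq_swap] at hne
    exact hne (X.hregion _ huR _ hcon.1 hcon.2)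
  · exact hcon.1 huR

/-- Named points lie in `R ∪ {ports}`. -/
theorem vtx_mem (u : NP) : X.vtx u ∈ X.R ∨ ∃ i, X.vtx u = X.p i := by
  rcases u with _ | i
  · exact Or.inl X.ho
  · exact Or.inr ⟨i, rfl⟩

/-- The inner open graph is a subgraph of the open graph. -/
theorem Gin_le (ω : BondConfig (Fin n)) : X.Gin ω ≤ openGraph ω := openGraph_mono inter_subset_left

/-- The outer open graph is a subgraph of the open graph. -/
theorem Gout_le (ω : BondConfig (Fin n)) : X.Gout ω ≤ openGraph ω := openGraph_mono inter_subset_left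

/-- A join-graph path is realised by an open path. -/
theorem reach_of_JG {ω : BondConfig (Fin n)} {u v : NP} (h : (X.JG ω).Reachable u v) :
    (openGraph ω).Reachable (X.vtx u) (X.vtx v) := by
  rw [SimpleGraph.reachable_iff_reflTransGen] at h
  induction h with
  | refl => rfl
  | tail _ hbc ih =>
    refine ih.trans ?_
    rcases (base_iff ω _ _).1 ((JG_adj ω _ _).1 hbc).2 with h | h | ⟨i, k, rfl, rfl, h⟩
    · rw [h]
    · exact h.mono (Gin_le ω)
    · exact h.mono (Gout_le ω)

/-- **The walk decomposition** (invariant form): everything reachable from a named point is reached through a `jrel`-joined named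
point by an inner path (if it lies in `R ∪ {ports}`) and through a `jrel`-joined port by an outer path (if it lies outside `R`). -/
theorem decomp {ω : BondConfig (Fin n)} (hω : ω ∈ X.supp) (v : NP) (a : Fin n)
    (h : (openGraph ω).Reachable (X.vtx v) a) :
    ((a ∈ X.R ∨ ∃ i, a = X.p i) → ∃ x : NP, (X.JG ω).Reachable v x ∧ (X.Gin ω).Reachable (X.vtx x) a) ∧
    (a ∉ X.R → ∃ i, (X.JG ω).Reachable v (some i) ∧ (X.Gout ω).Reachable (X.p i) a) := by
  rw [SimpleGraph.reachable_iff_reflTransGen] at h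
  induction h with
  | refl =>
    refine ⟨fun _ => ⟨v, SimpleGraph.Reachable.refl _, SimpleGraph.Reachable.refl _⟩, fun hv => ?_⟩
    rcases v with _ | i
    · exact absurd X.ho hv
    · exact ⟨i, SimpleGraph.Reachable.refl _, SimpleGraph.Reachable.refl _⟩
  | @tail b c _ hbc ih =>
    obtain ⟨hmem, hne⟩ := (openGraph_adj ω b c).1 hbc
    by_cases hF : s(b, c) ∈ X.F
    · -- inner step: both endpoints in `R ∪ ports`
      have hb := endpoints_of_inner hω hmem hF b (Sym2.mem_mk_left b c)
      have hc := endpoints_of_inner hω hmem hF c (Sym2.mem_mk_right b c)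
      have hadj : (X.Gin ω).Adj b c := (openGraph_adj _ b c).2 ⟨⟨hmem, Finset.mem_coe.2 hF⟩, hne⟩
      obtain ⟨x, hvx, hxb⟩ := ih.1 hb
      refine ⟨fun _ => ⟨x, hvx, hxb.trans hadj.reachable⟩, fun hcR => ?_⟩
      rcases hc with hcR' | ⟨k, rfl⟩
      · exact absurd hcR' hcR
      · refine ⟨k, hvx.trans (JG_reach_of_base ω ((base_iff ω x (some k)).2 (Or.inr (Or.inl ?_)))),
          SimpleGraph.Reachable.refl _⟩
        exact hxb.trans hadj.reachable
    · -- outer step: both endpoints outside `R`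
      have hbR : b ∉ X.R := fun hbR => hF (Finset.mem_filter.2 ⟨Finset.mem_univ _, b, hbR, Sym2.mem_mk_left b c⟩)
      have hcR : c ∉ X.R := fun hcR => hF (Finset.mem_filter.2 ⟨Finset.mem_univ _, c, hcR, Sym2.mem_mk_right b c⟩)
      have hadj : (X.Gout ω).Adj b c :=
        (openGraph_adj _ b c).2 ⟨⟨hmem, fun h => hF (Finset.mem_coe.1 h)⟩, hne⟩
      obtain ⟨i, hvi, hib⟩ := ih.2 hbR
      refine ⟨fun hc => ?_, fun _ => ⟨i, hvi, hib.trans hadj.reachable⟩⟩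
      rcases hc with hcR' | ⟨k, rfl⟩
      · exact absurd hcR' hcR
      · refine ⟨some k, hvi.trans (JG_reach_of_base ω ((base_iff ω (some i) (some k)).2
          (Or.inr (Or.inr ⟨i, k, rfl, rfl, hib.trans hadj.reachable⟩)))), SimpleGraph.Reachable.refl _⟩

/-- **Join lemma.**  On the support event, for a named point `u` and a vertex `a ∉ R`:  `u ↔ a` iff some port is `jrel`-joined to
`u` and outer-joined to `a`. -/
theorem reach_iff_join {ω : BondConfig (Fin n)} (hω : ω ∈ X.supp) (u : NP) {a : Fin n} (ha : a ∉ X.R) :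
    (openGraph ω).Reachable (X.vtx u) a ↔
      ∃ i, jrel (X.ibits ω) (X.obits ω) u (some i) = true ∧ (X.Gout ω).Reachable (X.p i) a := by
  constructor
  · intro h
    obtain ⟨i, hui, hia⟩ := (decomp hω u a h).2 ha
    exact ⟨i, (jrel_iff_JG ω u (some i)).2 hui, hia⟩
  · rintro ⟨i, hui, hia⟩
    exact (reach_of_JG ((jrel_iff_JG ω u (some i)).1 hui)).trans (hia.mono (Gout_le ω))

/-- Named point to port: `u ↔ p k` iff `jrel u (some k)`. -/
theorem reach_port_iff {ω : BondConfig (Fin n)} (hω : ω ∈ X.supp) (u : NP) (k : Fin 3) :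
    (openGraph ω).Reachable (X.vtx u) (X.p k) ↔ jrel (X.ibits ω) (X.obits ω) u (some k) = true := by
  rw [reach_iff_join hω u (X.hp k)]
  constructor
  · rintro ⟨i, hui, hik⟩
    rw [jrel_iff_JG] at hui ⊢
    exact hui.trans (JG_reach_of_base ω ((base_iff ω (some i) (some k)).2 (Or.inr (Or.inr ⟨i, k, rfl, rfl, hik⟩))))
  · intro h
    exact ⟨k, h, SimpleGraph.Reachable.refl _⟩

/-- The inner bits of a configuration form a closed pattern. -/
theorem closed_ibits (ω : BondConfig (Fin n)) : (X.ibits ω).closed = true := by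
  -- with the discrete outer record, `base` steps are inner steps, so `jrel` is inner reachability
  have key : ∀ u v : NP, jrel (X.ibits ω) OB.disc u v = true ↔ u = v ∨ (X.Gin ω).Reachable (X.vtx u) (X.vtx v) := by
    have hb : ∀ u v : NP, base (X.ibits ω) OB.disc u v = true ↔ u = v ∨ (X.Gin ω).Reachable (X.vtx u) (X.vtx v) := by
      intro u v
      rw [base, Bool.or_eq_true, Bool.or_eq_true, rel_ibits, decide_eq_true_iff]
      have : OB.disc.rel u v = false := by
        rcases u with _ | i <;> rcases v with _ | k
        · rfl
        · rfl
        · rfl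
        · fin_cases i <;> fin_cases k <;> rfl
      rw [this]
      simp only [ir, decide_eq_true_iff, Bool.false_eq_true, or_false]
      constructor
      · rintro (h | h); exact Or.inl h; exact Or.inr h.2
      · rintro (h | h); exact Or.inl h
        by_cases huv : u = v; exact Or.inl huv; exact Or.inr ⟨huv, h⟩
    intro u v
    rw [jrel_eq_true_iff]
    constructor
    · rintro ⟨a, a', h1, h2, h3⟩
      have lift : ∀ {x y : NP}, base (X.ibits ω) OB.disc x y = true → (X.Gin ω).Reachable (X.vtx x) (X.vtx y) := by
        intro x y h
        rcases (hb x y).1 h with h | h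
        · rw [h]
        · exact h
      exact Or.inr (((lift h1).trans (lift h2)).trans (lift h3))
    · intro h
      exact ⟨v, v, (hb u v).2 h, base_refl _ _ _, base_refl _ _ _⟩
  have hbit : ∀ u v : NP, u ≠ v → (jrel (X.ibits ω) OB.disc u v == X.ir ω u v) = true := by
    intro u v huv
    rw [beq_iff_eq]
    rw [Bool.eq_iff_iff, key, ir, decide_eq_true_iff]
    constructor
    · rintro (h | h); exact absurd h huv; exact ⟨huv, h⟩
    · rintro ⟨_, h⟩; exact Or.inr h
  simp only [IB.closed, ibits, Bool.and_eq_true]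
  exact ⟨⟨⟨⟨⟨hbit _ _ (by simp), hbit _ _ (by simp)⟩, hbit _ _ (by simp)⟩, hbit _ _ (by simp)⟩, hbit _ _ (by simp)⟩,
    hbit _ _ (by simp)⟩

end Hull3

end HullThree

end Summit.CriticalPhenomena.PercolationContinuityZ3.Theorems

end
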